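/-
Copyright (c) 2026. All rights reserved.
Released under Apache 2.0 license as described in the file LICENSE.
-/
import Summits.Langlands.Langlands.Theorems.SoloInformedRepairD2CrisKzeroAction
import HarnessLib

/-!
# The `ℤ_p`-polynomial `Ψ_a` of a Teichmüller period `u_a = [ā] ∈ B_max(F)`

Third input-free proof-side rung of the D2-cris repair (`SoloInformedRepairD2Cris.lean` §4,
`CrystallineCompatibleAt`: `charpoly (φ_D^{f}) = P^{f}` on `D_cris(ρ|Γ_{K_v})`, `q_v = p^f`), after the
`K₀`-periods (`…D2CrisTeichmuller`, `…D2CrisResidueDegree`) and the `K₀`-action `M_a`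
(`…D2CrisKzeroAction`); part one of two (part two, `…D2CrisOrbit`, evaluates `Ψ_a` at `M_a` on `D_cris(ρ_v)`).
Everything here is unconditional (no `θ`-surjectivity, no `B_max^{Γ_F} = F₀`, no injectivity of `φ`).

* §1 `W(k)^{φ=1} = ℤ_p` for any field `k` of characteristic `p` (`exists_eq_zpToWitt_of_frobenius_eq`),
  coefficientwise from `k^{x^p = x} = 𝔽_p`, and its polynomial form via `Polynomial.lifts`
  (`exists_map_zpToWitt_eq_of_map_frobenius_eq`); Teichmüller differences `[x] - [y]`, `x ≠ y`, are units
  of `W(k)` (`isUnit_teichmuller_sub`).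
* §2 the Frobenius-orbit polynomial `Π_t = ∏_{i<f} (X - t^{p^i})` (`orbitPoly`): monic of degree `f`, mapped to
  itself by any ring map `σ` with `σ t = t^p` once `t^{p^f} = t` (`map_orbitPoly_of_apply_eq_pow`), and
  `Π_t ∣ Π_t(X^p)` (`orbitPoly_dvd_expand`; pure algebra, `X - s ∣ X^p - s^p`).
* §3 for `q_F = p^f` and `a ∈ 𝒪_F`: **the `ℤ_p`-polynomial `Ψ_a` of the Teichmüller period `u_a = [ā]`**
  (`teichMinpoly`, the descent of `Π_{[ā]} ∈ W(k̄)[X]` along the injective `ℤ_p → W(k̄)`): monic of degree `f`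
  (`teichMinpoly_monic`, `natDegree_teichMinpoly`), `Ψ_a ↦ ∏_{i<f} (X - u_a^{p^i})` in `B_max(F)[X]`
  (`map_zpToBmax_teichMinpoly`, through `ℤ_p → W(k̄) → A_inf → B_max⁺ → B_max`, `wittToAinf_comp_zpToWitt`),
  **`Ψ_a(u_a) = 0`** (`eval₂_teichMinpoly_teichBmax`) and `Ψ_a ∣ Ψ_a(X^p)` in `ℤ_p[X]`
  (`teichMinpoly_dvd_expand`).  For `ā` of degree `f` over `𝔽_p`, `Ψ_a` is the minimal polynomial of `u_a`
  over `ℚ_p` (irreducibility is not needed downstream and not proved).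

References: Fontaine, *Le corps des périodes p-adiques*, Astérisque 223 (1994), Exp. II §2.3, Exp. III §1.5;
Serre, *Local Fields*, Ch. II §§4–6; Colmez, Ann. of Math. 148 (1998), §III.2.
-/

noncomputable section

open scoped MatrixGroups TensorProduct ValuativeRel Polynomial
open Field IsLocalRing ValuativeRel Polynomial
open Literature.NumberTheory.GaloisRepresentations Literature.NumberTheory.PAdicHodge
open Literature.NumberTheory.GaloisRepresentations.IsNonarchimedeanLocalField

namespace Summit.Langlands.Langlands.Theorems

namespace D2Cris

open D2St

/-! ### §1 Prime-field descent in `W(k)`: `W(k)^{φ = 1} = ℤ_p`; Teichmüller differences are units -/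

section WittDescent

variable (p : ℕ) [Fact p.Prime] (k : Type*) [Field k] [CharP k p]

/-- **`ℤ_p = W(𝔽_p) → W(k)`** for a field `k` of characteristic `p`.
[cite: SerreLocalFields1979, Ch. II §6] -/
def zpToWitt : ℤ_[p] →+* WittVector p k :=
  (WittVector.map (ZMod.castHom (dvd_refl p) k)).comp (WittVector.equiv p).symm.toRingHom

variable {p k}

/-- Witt components of `zpToWitt c`. [folklore] -/
theorem coeff_zpToWitt (c : ℤ_[p]) (n : ℕ) :
    (zpToWitt p k c).coeff n = ZMod.castHom (dvd_refl p) k (((WittVector.equiv p).symm c).coeff n) := by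
  simp [zpToWitt, WittVector.map_coeff]

/-- `ℤ_p → W(k)` is injective. [folklore] -/
theorem zpToWitt_injective : Function.Injective (zpToWitt p k) :=
  (WittVector.map_injective _ (ZMod.castHom (dvd_refl p) k).injective).comp
    (WittVector.equiv p).symm.injective

/-- `φ` fixes `ℤ_p ⊆ W(k)`. [folklore] -/
theorem frobenius_zpToWitt (c : ℤ_[p]) :
    WittVector.frobenius (zpToWitt p k c) = zpToWitt p k c := by
  ext n
  simp only [WittVector.coeff_frobenius_charP, coeff_zpToWitt, ← map_pow, ZMod.pow_card]

/-- **`W(k)^{φ = 1} = ℤ_p`**: a Frobenius-fixed Witt vector over a field of characteristic `p` has all its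
components in `𝔽_p`, hence comes from `ℤ_p`. [cite: SerreLocalFields1979, Ch. II §6] -/
theorem exists_eq_zpToWitt_of_frobenius_eq {x : WittVector p k} (hx : WittVector.frobenius x = x) :
    ∃ c : ℤ_[p], x = zpToWitt p k c := by
  have hc : ∀ n : ℕ, ∃ z : ℤ, (z : k) = x.coeff n := fun n => by
    have h : x.coeff n ^ p = x.coeff n := by
      rw [← WittVector.coeff_frobenius_charP, hx]
    exact (mem_bot_iff_intCast p k).1 ((Subfield.mem_bot_iff_pow_eq_self k p).2 h)
  choose z hz using hc
  refine ⟨WittVector.equiv p (WittVector.mk p fun n => (z n : ZMod p)), ?_⟩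
  ext n
  rw [coeff_zpToWitt, RingEquiv.symm_apply_apply, WittVector.coeff_mk, map_intCast, hz]

/-- Polynomial form: a MONIC `φ`-fixed polynomial over `W(k)` is the image of a monic polynomial over `ℤ_p`
of the same degree. [folklore] -/
theorem exists_map_zpToWitt_eq_of_map_frobenius_eq {Φ : (WittVector p k)[X]}
    (hΦ : Φ.map (WittVector.frobenius : WittVector p k →+* WittVector p k) = Φ) (hmonic : Φ.Monic) :
    ∃ Ψ : ℤ_[p][X], Ψ.map (zpToWitt p k) = Φ ∧ Ψ.natDegree = Φ.natDegree ∧ Ψ.Monic := by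
  refine Polynomial.lifts_and_natDegree_eq_and_monic
    ((Polynomial.lifts_iff_coeff_lifts _).2 fun n => ?_) hmonic
  have h : WittVector.frobenius (Φ.coeff n) = Φ.coeff n := by
    rw [← Polynomial.coeff_map, hΦ]
  obtain ⟨c, hc⟩ := exists_eq_zpToWitt_of_frobenius_eq h
  exact ⟨c, hc.symm⟩

/-- **`[x] - [y]` is a unit of `W(k)` for `x ≠ y`** (its constant component is `x - y ≠ 0`).
[cite: SerreLocalFields1979, Ch. II §6] -/
theorem isUnit_teichmuller_sub {x y : k} (h : x ≠ y) :
    IsUnit (WittVector.teichmuller p x - WittVector.teichmuller p y) := by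
  refine WittVector.isUnit_of_coeff_zero_ne_zero _ ?_
  have h0 : (WittVector.teichmuller p x - WittVector.teichmuller p y).coeff 0 = x - y := by
    change WittVector.constantCoeff (WittVector.teichmuller p x - WittVector.teichmuller p y) = x - y
    rw [map_sub]
    rfl
  rw [h0]
  exact sub_ne_zero.2 h

end WittDescent

/-! ### §2 The Frobenius-orbit polynomial `Π_t = ∏_{i<f} (X - t^{p^i})` -/

section Orbit

variable (p : ℕ) {R S : Type*} [CommRing R] [CommRing S]

/-- **`Π_t := ∏_{i<f} (X - t^{p^i})`.** [folklore] -/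
def orbitPoly (t : R) (f : ℕ) : R[X] := ∏ i ∈ Finset.range f, (X - C (t ^ p ^ i))

variable {p}

/-- `Π_t` is monic. [folklore] -/
theorem orbitPoly_monic (t : R) (f : ℕ) : (orbitPoly p t f).Monic :=
  Polynomial.monic_prod_of_monic _ _ fun _ _ => Polynomial.monic_X_sub_C _

/-- `deg Π_t = f`. [folklore] -/
theorem natDegree_orbitPoly [Nontrivial R] (t : R) (f : ℕ) : (orbitPoly p t f).natDegree = f := by
  rw [orbitPoly, Polynomial.natDegree_prod_of_monic _ _ fun i _ => Polynomial.monic_X_sub_C _]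
  simp only [Polynomial.natDegree_X_sub_C, Finset.sum_const, Finset.card_range, smul_eq_mul, mul_one]

/-- `Π_t` is natural in ring homomorphisms. [folklore] -/
theorem map_orbitPoly (g : R →+* S) (t : R) (f : ℕ) : (orbitPoly p t f).map g = orbitPoly p (g t) f := by
  simp only [orbitPoly, Polynomial.map_prod, Polynomial.map_sub, Polynomial.map_X, Polynomial.map_pow,
    Polynomial.map_C, map_pow]

/-- `Π_t(t) = 0` for `f > 0`. [folklore] -/
theorem eval_orbitPoly_self (t : R) {f : ℕ} (hf : 0 < f) : (orbitPoly p t f).eval t = 0 := by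
  rw [orbitPoly, Polynomial.eval_prod]
  exact Finset.prod_eq_zero (Finset.mem_range.2 hf) (by simp)

/-- Cyclic shift of a product over `range f` whose term `f` equals its term `0`. [folklore] -/
theorem prod_range_shift {M : Type*} [CommMonoidWithZero M] [IsRightCancelMulZero M] (g : ℕ → M)
    {f : ℕ} (h : g f = g 0) (h0 : g 0 ≠ 0) :
    ∏ i ∈ Finset.range f, g (i + 1) = ∏ i ∈ Finset.range f, g i :=
  mul_right_cancel₀ h0 <| (Finset.prod_range_succ' g f).symm.trans ((Finset.prod_range_succ g f).trans (by rw [h]))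

/-- **`Π_t` is fixed by any `σ` with `σ t = t^p`, provided `t^{p^f} = t`** (it permutes the factors
cyclically). [folklore] -/
theorem map_orbitPoly_of_apply_eq_pow [IsDomain R] (σ : R →+* R) {t : R} (hσ : σ t = t ^ p) {f : ℕ}
    (ht : t ^ p ^ f = t) : (orbitPoly p t f).map σ = orbitPoly p t f := by
  rw [map_orbitPoly, hσ, orbitPoly, orbitPoly]
  have hpow : ∀ i : ℕ, (t ^ p) ^ p ^ i = t ^ p ^ (i + 1) := fun i => by rw [← pow_mul, pow_succ']
  simp_rw [hpow]
  exact prod_range_shift (fun i => X - C (t ^ p ^ i)) (by simp only [ht, pow_zero, pow_one])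
    (Polynomial.X_sub_C_ne_zero _)

/-- **`Π_t ∣ Π_t(X^p)` when `t^{p^f} = t`**: `X - t^{p^i} ∣ X^p - t^{p^{i+1}}` factorwise. [folklore] -/
theorem orbitPoly_dvd_expand [Fact p.Prime] [IsDomain R] {t : R} {f : ℕ} (ht : t ^ p ^ f = t) :
    orbitPoly p t f ∣ Polynomial.expand R p (orbitPoly p t f) := by
  have hp : 0 < p := (Fact.out : p.Prime).pos
  have hexp : Polynomial.expand R p (orbitPoly p t f) =
      ∏ i ∈ Finset.range f, (X ^ p - C (t ^ p ^ (i + 1))) := by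
    rw [orbitPoly, map_prod]
    simp only [map_sub, Polynomial.expand_X, Polynomial.expand_C]
    exact (prod_range_shift (fun i => X ^ p - C (t ^ p ^ i)) (by simp only [ht, pow_zero, pow_one])
      (Polynomial.X_pow_sub_C_ne_zero hp _)).symm
  rw [hexp, orbitPoly]
  exact Finset.prod_dvd_prod_of_dvd _ _ fun i _ => by
    rw [pow_succ, pow_mul, map_pow C (t ^ p ^ i) p]
    exact sub_dvd_pow_sub_pow X (C (t ^ p ^ i)) p

end Orbit

/-! ### §3 The `ℤ_p`-polynomial `Ψ_a` of the Teichmüller period `u_a = [ā]` -/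

variable {F : Type} [Field F] [ValuativeRel F] [TopologicalSpace F] [IsNonarchimedeanLocalField F]
  [CharZero F] {p : ℕ} [Fact p.Prime] [Fact (¬ IsUnit (p : maxUnramifiedCompletion F))]
  [CharP (IsLocalRing.ResidueField (maxUnramifiedCompletion F)) p] [Fact (¬ IsUnit (p : integerC F))]
  [IsAdicComplete (Ideal.span {(p : integerC F)}) (integerC F)] {m : ℕ}

omit [CharZero F] [IsAdicComplete (Ideal.span {(p : integerC F)}) (integerC F)]
  [Fact (¬ IsUnit (p : integerC F))] [Fact (¬ IsUnit (p : maxUnramifiedCompletion F))] in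
/-- `φ [ā] = [ā]^p` in `W(k̄)`. [cite: SerreLocalFields1979, Ch. II §6] -/
theorem frobenius_teichmuller_resBar (a : 𝒪[F]) :
    WittVector.frobenius (WittVector.teichmuller p (resBar F a)) = WittVector.teichmuller p (resBar F a) ^ p := by
  rw [WittVector.frobenius_eq_map_frobenius, WittVector.map_teichmuller, frobenius_def, map_pow]

omit [CharZero F] [IsAdicComplete (Ideal.span {(p : integerC F)}) (integerC F)]
  [Fact (¬ IsUnit (p : integerC F))] [Fact (¬ IsUnit (p : maxUnramifiedCompletion F))]
  [CharP (IsLocalRing.ResidueField (maxUnramifiedCompletion F)) p] in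
/-- `[ā]^{q_F} = [ā]` in `W(k̄)`. [folklore] -/
theorem teichmuller_resBar_pow_residueFieldCard (a : 𝒪[F]) :
    WittVector.teichmuller p (resBar F a) ^ residueFieldCard F = WittVector.teichmuller p (resBar F a) := by
  rw [← map_pow, resBar_pow_residueFieldCard]

omit [IsAdicComplete (Ideal.span {(p : integerC F)}) (integerC F)] in
/-- **`ℤ_p → W(k̄) → A_inf(F)` is the structural `ℤ_p → A_inf(F)`** (both are `W` of the unique
`𝔽_p → 𝒪_{ℂ_F}♭`). [folklore] -/
theorem wittToAinf_comp_zpToWitt :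
    (wittToAinf F p).comp (zpToWitt p (ResidueField (maxUnramifiedCompletion F))) = zpToAinf := by
  have hψ : (tiltMap p (toCInt₀ F)).comp ((residueTiltEquiv F p).toRingHom.comp
      (ZMod.castHom (dvd_refl p) (ResidueField (maxUnramifiedCompletion F)))) =
      ZMod.castHom (dvd_refl p) (PreTilt (integerC F) p) := Subsingleton.elim _ _
  refine RingHom.ext fun c => WittVector.ext fun n => ?_
  have h2 : (zpToAinf c : Ainf (p := p) F).coeff n =
      ZMod.castHom (dvd_refl p) (PreTilt (integerC F) p) (((WittVector.equiv p).symm c).coeff n) := by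
    simp [zpToAinf, WittVector.map_coeff]
  rw [RingHom.comp_apply, coeff_wittToAinf, coeff_zpToWitt, h2]
  exact RingHom.congr_fun hψ _

section Minpoly

variable {f : ℕ} (hq : residueFieldCard F = p ^ f)
include hq

omit [CharZero F] [IsAdicComplete (Ideal.span {(p : integerC F)}) (integerC F)]
  [Fact (¬ IsUnit (p : integerC F))] [Fact (¬ IsUnit (p : maxUnramifiedCompletion F))]
  [CharP (IsLocalRing.ResidueField (maxUnramifiedCompletion F)) p] [Fact p.Prime] in
/-- `q_F = p^f` forces `f > 0`. [folklore] -/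
theorem pos_of_residueFieldCard_eq : 0 < f := by
  rcases Nat.eq_zero_or_pos f with rfl | h
  · rw [pow_zero] at hq
    exact absurd hq (one_lt_residueFieldCard F).ne'
  · exact h

omit [CharZero F] [IsAdicComplete (Ideal.span {(p : integerC F)}) (integerC F)]
  [Fact (¬ IsUnit (p : integerC F))] [Fact (¬ IsUnit (p : maxUnramifiedCompletion F))]
  [CharP (IsLocalRing.ResidueField (maxUnramifiedCompletion F)) p] in
/-- `[ā]^{p^f} = [ā]`. [folklore] -/
theorem teichmuller_resBar_pow_pow (a : 𝒪[F]) :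
    WittVector.teichmuller p (resBar F a) ^ p ^ f = WittVector.teichmuller p (resBar F a) := by
  rw [← hq, teichmuller_resBar_pow_residueFieldCard]

omit [CharZero F] [IsAdicComplete (Ideal.span {(p : integerC F)}) (integerC F)]
  [Fact (¬ IsUnit (p : integerC F))] [Fact (¬ IsUnit (p : maxUnramifiedCompletion F))] in
/-- The orbit polynomial of `[ā]` descends to a monic `Ψ ∈ ℤ_p[X]` of degree `f`. [folklore] -/
theorem exists_teichMinpoly (a : 𝒪[F]) : ∃ Ψ : ℤ_[p][X],
    Ψ.map (zpToWitt p (ResidueField (maxUnramifiedCompletion F))) =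
      orbitPoly p (WittVector.teichmuller p (resBar F a)) f ∧ Ψ.natDegree = f ∧ Ψ.Monic := by
  obtain ⟨Ψ, h1, h2, h3⟩ := exists_map_zpToWitt_eq_of_map_frobenius_eq
    (map_orbitPoly_of_apply_eq_pow _ (frobenius_teichmuller_resBar a) (teichmuller_resBar_pow_pow hq a))
    (orbitPoly_monic _ _)
  exact ⟨Ψ, h1, h2.trans (natDegree_orbitPoly _ _), h3⟩

omit [CharZero F] [IsAdicComplete (Ideal.span {(p : integerC F)}) (integerC F)]
  [Fact (¬ IsUnit (p : integerC F))] in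
/-- **`Ψ_a ∈ ℤ_p[X]`, the `ℤ_p`-polynomial of the Teichmüller period `u_a`** (for `q_F = p^f`): the descent
to `ℤ_p` of `∏_{i<f} (X - [ā]^{p^i})`; for `ā` of degree `f` over `𝔽_p` it is the minimal polynomial of
`[ā]`, i.e. of a primitive element of `𝒪_{F₀} = W(k_F)` over `ℤ_p`. [cite: SerreLocalFields1979, Ch. II §6]
[cite: FontaineAsterisque223III, Exp. II §2.3] -/
def teichMinpoly (a : 𝒪[F]) : ℤ_[p][X] := Classical.choose (exists_teichMinpoly (p := p) hq a)

omit [CharZero F] [IsAdicComplete (Ideal.span {(p : integerC F)}) (integerC F)]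
  [Fact (¬ IsUnit (p : integerC F))] [Fact (¬ IsUnit (p : maxUnramifiedCompletion F))] in
/-- `Ψ_a ↦ ∏_{i<f} (X - [ā]^{p^i})` in `W(k̄)[X]`. [folklore] -/
theorem map_zpToWitt_teichMinpoly (a : 𝒪[F]) :
    (teichMinpoly hq a).map (zpToWitt p (ResidueField (maxUnramifiedCompletion F))) =
      orbitPoly p (WittVector.teichmuller p (resBar F a)) f :=
  (Classical.choose_spec (exists_teichMinpoly (p := p) hq a)).1

omit [CharZero F] [IsAdicComplete (Ideal.span {(p : integerC F)}) (integerC F)]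
  [Fact (¬ IsUnit (p : integerC F))] [Fact (¬ IsUnit (p : maxUnramifiedCompletion F))] in
/-- `deg Ψ_a = f`. [folklore] -/
theorem natDegree_teichMinpoly (a : 𝒪[F]) : (teichMinpoly (p := p) hq a).natDegree = f :=
  (Classical.choose_spec (exists_teichMinpoly (p := p) hq a)).2.1

omit [CharZero F] [IsAdicComplete (Ideal.span {(p : integerC F)}) (integerC F)]
  [Fact (¬ IsUnit (p : integerC F))] [Fact (¬ IsUnit (p : maxUnramifiedCompletion F))] in
/-- `Ψ_a` is monic. [folklore] -/
theorem teichMinpoly_monic (a : 𝒪[F]) : (teichMinpoly (p := p) hq a).Monic :=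
  (Classical.choose_spec (exists_teichMinpoly (p := p) hq a)).2.2

omit [CharZero F] [IsAdicComplete (Ideal.span {(p : integerC F)}) (integerC F)]
  [Fact (¬ IsUnit (p : integerC F))] [Fact (¬ IsUnit (p : maxUnramifiedCompletion F))] in
/-- **`Ψ_a ∣ Ψ_a(X^p)` in `ℤ_p[X]`**: the root set of `Ψ_a` in any `ℤ_p`-algebra is stable under `c ↦ c^p`
(descent of `orbitPoly_dvd_expand` along the injective `ℤ_p → W(k̄)`, `Ψ_a` monic). [folklore] -/
theorem teichMinpoly_dvd_expand (a : 𝒪[F]) :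
    teichMinpoly hq a ∣ Polynomial.expand ℤ_[p] p (teichMinpoly hq a) := by
  have hm := teichMinpoly_monic hq a
  rw [← Polynomial.modByMonic_eq_zero_iff_dvd hm]
  apply Polynomial.map_injective (zpToWitt p (ResidueField (maxUnramifiedCompletion F))) zpToWitt_injective
  rw [Polynomial.map_modByMonic _ hm, Polynomial.map_expand, map_zpToWitt_teichMinpoly, Polynomial.map_zero,
    Polynomial.modByMonic_eq_zero_iff_dvd (orbitPoly_monic _ _)]
  exact orbitPoly_dvd_expand (teichmuller_resBar_pow_pow hq a)

/-- **`Ψ_a ↦ ∏_{i<f} (X - u_a^{p^i})` in `B_max(F)[X]`.** [cite: FontaineAsterisque223III, Exp. II §2.3] -/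
theorem map_zpToBmax_teichMinpoly (a : 𝒪[F]) :
    (teichMinpoly hq a).map (zpToBmax F p) = orbitPoly p (teichBmax (p := p) a) f := by
  have h : zpToBmax F p = ((ainfToBmax F p).comp (wittToAinf F p)).comp
      (zpToWitt p (ResidueField (maxUnramifiedCompletion F))) := by
    rw [RingHom.comp_assoc, wittToAinf_comp_zpToWitt]
    exact RingHom.ext fun c => (ainfToBmax_zpToAinf c).symm
  rw [h, ← Polynomial.map_map, map_zpToWitt_teichMinpoly, map_orbitPoly]
  rfl

/-- **`Ψ_a(u_a) = 0` in `B_max(F)`.** [cite: FontaineAsterisque223III, Exp. II §2.3] -/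
theorem eval₂_teichMinpoly_teichBmax (a : 𝒪[F]) :
    (teichMinpoly hq a).eval₂ (zpToBmax F p) (teichBmax a) = 0 := by
  rw [← Polynomial.eval_map, map_zpToBmax_teichMinpoly, eval_orbitPoly_self _ (pos_of_residueFieldCard_eq hq)]

end Minpoly

end D2Cris

end Summit.Langlands.Langlands.Theorems
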